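import Summits.MatrixMultiplication.OmegaCensus.SmallFormats.GF2TreeSplit
import Summits.MatrixMultiplication.OmegaCensus.SmallFormats.GF2TransposeLookup
import Literature.Computability.AlgebraicComplexity.SubstitutionLPBacktracking
import HarnessLib

/-!
# ω-census family (a), GF(2) rank floors: the extended sweep (transposed lookups and LP leaves)

Cell `pub-mm22` (MatrixMultiplication venture, Route D3-STRETCH `20 ≤ R_𝔽₂(⟨3,3,3⟩)`), topic
`Summits/MatrixMultiplication/OmegaCensus` (sub-folder `SmallFormats`, next to `GF2OrbitSweep.lean`).
Framing (verbatim): lottery ticket; floor = certified bounds/negative ranges. HONEST FRAMING: replay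
infrastructure — a kernel CHECKER for regenerated Wang-2026-style certificates of a SQUARE first factor
(`l = m`) whose steps may, in addition to everything `GF2OrbitSweep.Step` offers (wrapped as `StepX.old`),
(i) look an orbit up through the transpose symmetry `X ↦ P Xᵀ Q` (Wang 2026 §4.1; `sandTB`,
`GF2TransposeLookup.lean`), (ii) close an orbit by ONE weighted family of substitution rows at the root
("LP leaf", `Literature/…/SubstitutionLPBound.lean`, `…/SubstitutionLPBacktracking.lean`:
`le_card_of_lpLeafOK_zero`), (iii) run a DFS round whose leaves are LP leaves (`NodeOKLP`,
`le_card_of_nodeOKLP_root`). Rows are candidate MASKS `(fm_j, y_j)` with denominator `D`; a candidate `n`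
is credited as killed by row `j` iff bit `n` of `fm_j` is set (membership — sound by definition of `S_F`; the
emitter lists span-closed sets), lookups `LB` go through two tables (plain sandwiches `sandB`, transposed
sandwiches `sandTB`). Nothing here is a bound; the instances (data + `decide`) live in sibling files.
Written by seat LIT-2 g3 as HAND-OVER material (landing: p3 successor / bench interim). PROVED, no facts.

(Landing note, p3 g2: the hand-over snippet is split at the gate's 400-line limit — this file = format, LP leaves/trees,
soundness up to `le_tensorRank_of_sweepX`; `GF2OrbitSweepLPSplit.lean` = obligations, side conditions / root checks / chain,
tree splitting, projections.)
-/

namespace Summit.MatrixMultiplication.OmegaCensus.GF2RankLB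

open Module Matrix Literature.Computability.AlgebraicComplexity

/-! ## LP leaves and LP trees on candidate masks -/

section Masks

variable {N : ℕ}

/-- The candidate set named by a mask. -/
def setOf (N fm : ℕ) : Finset (Fin N) := Finset.univ.filter fun i : Fin N => fm.testBit i

/-- Membership in `setOf` is the bit test. -/
theorem decide_mem_setOf (fm : ℕ) (i : Fin N) : decide (i ∈ setOf N fm) = fm.testBit i := by
  by_cases h : fm.testBit i = true <;> simp [setOf, h]

/-- The membership kill predicate: candidate `n` is credited to `F` iff `n ∈ F`. -/
def killMem (F : Finset (Fin N)) (n : Fin N) : Bool := decide (n ∈ F)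

/-- `killMem` is sound: a candidate listed in `F` vanishes on `S_F`. -/
theorem killMem_sound {k U : Type*} [Field k] [AddCommGroup U] [Module k U] (K : List (Dual k U))
    (c : Fin N → Dual k U) :
    ∀ F n, killMem F n = true → ∀ u : U, u ∈ constrSubF K c F → c n u = 0 :=
  fun _ n hn _ hu => (mem_constrSubF.1 hu).2 n (of_decide_eq_true hn)

variable (LBm : ℕ → ℕ) (target maxDepth : ℕ)

/-- Boolean LP-leaf test on mask rows `(fm_j, y_j)` with denominator `D` at the node `s` of depth `d`:
dual feasibility `∑_{j : bit nn of fm_j clear} y_j ≤ D` for every candidate `nn` above all entries of `s`, and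
the closing inequality `(target-1)·D + d·∑ y_j < ∑ y_j·(LB_j + #{p < d | bit (s p) of fm_j set}) + D·d`. -/
def lpLeafMB (rows : List (ℕ × ℕ)) (D : ℕ) (d : ℕ) (s : Fin d → Fin N) : Bool :=
  decide (∀ nn : Fin N, (∀ p : Fin d, s p ≤ nn) →
      ∑ j ∈ Finset.univ.filter (fun j : Fin rows.length => (rows.get j).1.testBit nn = false),
        (rows.get j).2 ≤ D) &&
  decide ((target - 1) * D + d * ∑ j : Fin rows.length, (rows.get j).2 <
      ∑ j : Fin rows.length, (rows.get j).2 * (LBm (rows.get j).1 +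
        (Finset.univ.filter fun p : Fin d => (rows.get j).1.testBit (s p) = true).card) + D * d)

/-- LP certificate trees on masks: leaves carry rows and a denominator, nodes one child per candidate. -/
inductive MCert (N : ℕ) : Type
  | leaf (rows : List (ℕ × ℕ)) (D : ℕ) : MCert N
  | node (cs : Fin N → MCert N) : MCert N

/-- Height of a tree (the fuel of `NodeOKLP`). -/
def MCert.height : MCert N → ℕ
  | .leaf _ _ => 0
  | .node cs => (Finset.univ.sup fun m => (cs m).height) + 1

/-- The replay check: leaves by `lpLeafMB`, nodes need `d < maxDepth` and all children above the path. -/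
def MCert.check : MCert N → (d : ℕ) → (Fin d → Fin N) → Bool
  | .leaf rows D, d, s => lpLeafMB LBm target rows D d s
  | .node cs, d, s => decide (d < maxDepth) &&
      decide (∀ m : Fin N, (∀ p : Fin d, s p ≤ m) → (cs m).check (d + 1) (Fin.snoc s m) = true)

variable {LBm target maxDepth}

/-- An accepted mask leaf is an `LPLeafOK` for the membership kill predicate. -/
theorem lpLeafOK_of_lpLeafMB {LB : Finset (Fin N) → ℕ} {rows : List (ℕ × ℕ)} {D d : ℕ}
    {s : Fin d → Fin N} (h : lpLeafMB (fun fm => LB (setOf N fm)) target rows D d s = true) :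
    LPLeafOK killMem LB target d s := by
  simp only [lpLeafMB, Bool.and_eq_true, decide_eq_true_eq] at h
  refine ⟨rows.length, fun j => setOf N (rows.get j).1, fun j => (rows.get j).2, D,
    fun n hn => ?_, ?_⟩
  · simpa only [killMem, decide_mem_setOf] using h.1 n hn
  · simpa only [killMem, decide_mem_setOf] using h.2

/-- Soundness of the tree replay: an accepted tree establishes `NodeOKLP` (fuel = height). -/
theorem MCert.nodeOKLP_of_check {LB : Finset (Fin N) → ℕ} : ∀ (t : MCert N) (d : ℕ) (s : Fin d → Fin N),
    t.check (fun fm => LB (setOf N fm)) target maxDepth d s = true →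
      NodeOKLP killMem LB target maxDepth t.height d s
  | .leaf rows D, d, s, h => by
    have hl : LPLeafOK killMem LB target d s := lpLeafOK_of_lpLeafMB (by simpa [MCert.check] using h)
    simp only [MCert.height]
    exact hl
  | .node cs, d, s, h => by
    simp only [MCert.check, Bool.and_eq_true, decide_eq_true_eq] at h
    obtain ⟨hd, hch⟩ := h
    simp only [MCert.height]
    refine Or.inr ⟨hd, fun m hm => ?_⟩
    have ih := MCert.nodeOKLP_of_check (cs m) (d + 1) (Fin.snoc s m) (hch m hm)
    exact ih.mono (Finset.le_sup (f := fun m => (cs m).height) (Finset.mem_univ m))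

variable {k : Type*} [Field k] {U V W : Type*} [AddCommGroup U] [Module k U] [AddCommGroup V]
  [Module k V] [AddCommGroup W] [Module k W] {φ : U →ₗ[k] V →ₗ[k] W} {K : List (Dual k U)}
  {c : Fin N → Dual k U} {LB : Finset (Fin N) → ℕ}

/-- **Root family of mask trees** (substitution with backtracking, LP leaves): soundness. -/
theorem le_card_of_checkM_root
    (hLB : ∀ F r, BilinComp (φ.comp (constrSubF K c F).subtype) (Fin r) → LB F ≤ r)
    (hcov : ∀ f : Dual k (constrSub K), f ≠ 0 → ∃ n, ∃ a : k, a ≠ 0 ∧ ∀ u, f u = a * c n u)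
    (hφ : φ.comp (constrSub K).subtype ≠ 0)
    (hdepth : ∀ r, BilinComp (φ.comp (constrSub K).subtype) (Fin r) → maxDepth ≤ r)
    (root : Fin N → MCert N)
    (hroot : ∀ m : Fin N, (root m).check (fun fm => LB (setOf N fm)) target maxDepth 1 (fun _ => m) = true)
    {ι : Type*} [Fintype ι] (β : BilinComp (φ.comp (constrSub K).subtype) ι) :
    target ≤ Fintype.card ι := by
  classical
  refine le_card_of_nodeOKLP_root hLB (killMem_sound K c) hcov hφ hdepth
    (Finset.univ.sup fun m => (root m).height) (fun m => ?_) β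
  exact (MCert.nodeOKLP_of_check (root m) 1 _ (hroot m)).mono
    (Finset.le_sup (f := fun m => (root m).height) (Finset.mem_univ m))

/-- **A mask leaf at the root** (the plain LP certificate of an orbit): soundness. -/
theorem le_card_of_lpLeafMB_zero
    (hLB : ∀ F r, BilinComp (φ.comp (constrSubF K c F).subtype) (Fin r) → LB F ≤ r)
    (hcov : ∀ f : Dual k (constrSub K), f ≠ 0 → ∃ n, ∃ a : k, a ≠ 0 ∧ ∀ u, f u = a * c n u)
    {rows : List (ℕ × ℕ)} {D : ℕ}
    (h : lpLeafMB (fun fm => LB (setOf N fm)) target rows D 0 (Fin.elim0 : Fin 0 → Fin N) = true)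
    {ι : Type*} [Fintype ι] (β : BilinComp (φ.comp (constrSub K).subtype) ι) :
    target ≤ Fintype.card ι := by
  refine le_card_of_lpLeafOK_zero hLB (killMem_sound K c) hcov (fun s => ?_) β
  have hs : s = Fin.elim0 := funext fun p => Fin.elim0 p
  rw [hs]
  exact lpLeafOK_of_lpLeafMB h

end Masks

/-! ## The extended certificate format -/

/-- Lookup rows `(F-mask, orbit, P, P⁻¹, Q, Q⁻¹)`. -/
abbrev LookRow := ℕ × ℕ × ℕ × ℕ × ℕ × ℕ

/-- One justification step of the extended format (square first factor). -/
inductive StepX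
  /-- any step of the basic format (flattenings, sandwich lookup, forced product, DFS round) -/
  | old (st : Step)
  /-- transposed lookup: `S_{K ++ extra}` contains `P (S_j)ᵀ Q` (witness `P, P⁻¹, Q, Q⁻¹`) -/
  | lookT (extra : List ℕ) (j P Pi Q Qi : ℕ)
  /-- LP leaf at the root: candidates, target, plain and transposed lookup tables, rows `(mask, y)`, `D` -/
  | lp (cands : List ℕ) (target : ℕ) (table tableT : List LookRow) (rows : List (ℕ × ℕ)) (D : ℕ)
  /-- DFS round with LP leaves: candidates, target, non-vanishing witness, two tables, root trees -/
  | dfsLP (cands : List ℕ) (target x b c : ℕ) (table tableT : List LookRow)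
      (roots : Fin cands.length → MCert cands.length)

/-- An orbit record of the extended format. -/
structure OrbitX where
  /-- constraint forms (bit patterns) -/
  K : List ℕ
  /-- claimed lower bound for all computations on `S_K` -/
  bound : ℕ
  /-- justification -/
  steps : List StepX

/-- The empty record. -/
instance : Inhabited OrbitX := ⟨⟨[], 0, []⟩⟩

/-- The lookup view of an extended certificate (constraint lists and claimed bounds; the basic checker reads
only these fields of OTHER orbits). -/
def coreOf (os : List OrbitX) : List Orbit := os.map fun o => ⟨o.K, o.bound, []⟩

/-- Mask-leaf helper for data files. -/
def ML (N : ℕ) (rows : List (ℕ × ℕ)) (D : ℕ) : MCert N := MCert.leaf rows D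

/-- Node helper for data files: children for the candidate indices `last, last+1, …` in order. -/
def MN {N : ℕ} (last : ℕ) (kids : List (MCert N)) : MCert N :=
  MCert.node fun mm => if last ≤ (mm : ℕ) then kids.getD ((mm : ℕ) - last) (MCert.leaf [] 1) else MCert.leaf [] 1

/-- Validity of a transposed lookup table: backward pointers and checked transposed sandwiches. -/
def tableTOK (l : ℕ) (osC : List Orbit) (i : ℕ) (K cands : List ℕ) (tableT : List LookRow) : Bool :=
  tableT.all fun e => decide (e.2.1 < i) &&
    sandTB l (kOf osC e.2.1) (K ++ extraOf cands e.1) e.2.2.1 e.2.2.2.1 e.2.2.2.2.1 e.2.2.2.2.2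

/-- The `LB` oracle of a round with two tables (best of the plain and the transposed lookup). -/
def lbOf2 (osC : List Orbit) (table tableT : List LookRow) {N : ℕ} (F : Finset (Fin N)) : ℕ :=
  max (lbOf osC table F) (lbOf osC tableT F)

variable (l n : ℕ)

/-- The bound certified by one extended step, given the bound `cur` certified so far (`0` on failure). -/
def stepBoundX (os : List OrbitX) (i : ℕ) (K : List ℕ) (cur : ℕ) : StepX → ℕ
  | .old st => stepBound l l n (coreOf os) i K cur st
  | .lookT extra j P Pi Q Qi =>
      if j < i ∧ sandTB l (kOf (coreOf os) j) (K ++ extra) P Pi Q Qi = true then bnd (coreOf os) j else 0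
  | .lp cands target table tableT rows D =>
      if coverB l l K cands = true ∧ tableOK l l (coreOf os) i K cands table = true ∧
          tableTOK l (coreOf os) i K cands tableT = true ∧
          lpLeafMB (fun fm => lbOf2 (coreOf os) table tableT (setOf cands.length fm)) target rows D 0
            (Fin.elim0 : Fin 0 → Fin cands.length) = true
      then target else 0
  | .dfsLP cands target x b c table tableT roots =>
      if target ≤ cur + 1 ∧ nzB l l n K x b c = true ∧ coverB l l K cands = true ∧
          tableOK l l (coreOf os) i K cands table = true ∧ tableTOK l (coreOf os) i K cands tableT = true ∧
          (∀ mm : Fin cands.length,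
            (roots mm).check (fun fm => lbOf2 (coreOf os) table tableT (setOf cands.length fm))
              target (target - 1) 1 (fun _ => mm) = true)
      then target else 0

/-- The bound certified by an orbit's steps. -/
def orbitBoundX (os : List OrbitX) (i : ℕ) : ℕ :=
  (os.getD i default).steps.foldl (fun cur st => max cur (stepBoundX l n os i (kOf (coreOf os) i) cur st)) 0

/-- The orbit check: the claimed bound is certified by the steps. -/
def orbitCheckX (os : List OrbitX) (i : ℕ) : Bool := decide (bnd (coreOf os) i ≤ orbitBoundX l n os i)

/-- The residual obligation of a step (only basic forced-product steps carry one). -/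
def StepXOblig (l n : ℕ) : StepX → Prop
  | .old st => StepOblig l n st
  | _ => True

/-- All residual obligations of orbit `i`. -/
def ObligsX (os : List OrbitX) (i : ℕ) : Prop := ∀ st ∈ (os.getD i default).steps, StepXOblig l n st

variable {l n}

/-! ## Soundness -/

/-- Claimed bounds in the lookup view. -/
theorem bnd_coreOf (os : List OrbitX) (j : ℕ) : bnd (coreOf os) j = (os.getD j default).bound := by
  simp only [bnd, coreOf, List.getD_eq_getElem?_getD, List.getElem?_map]
  cases os[j]? <;> rfl

/-- Constraint lists in the lookup view. -/
theorem kOf_coreOf (os : List OrbitX) (j : ℕ) : kOf (coreOf os) j = (os.getD j default).K := by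
  simp only [kOf, coreOf, List.getD_eq_getElem?_getD, List.getElem?_map]
  cases os[j]? <;> rfl

/-- Length of the lookup view. -/
@[simp] theorem length_coreOf (os : List OrbitX) : (coreOf os).length = os.length := by
  simp [coreOf]

/-- Soundness of a plain lookup table (the `hLB` hypothesis of the DFS theorems). -/
theorem lbOf_le {l m n : ℕ} (osC : List Orbit) (i : ℕ) (IH : ∀ j < i, Cert l m n (kOf osC j) (bnd osC j))
    (K cands : List ℕ) (table : List LookRow) (htab : tableOK l m osC i K cands table = true)
    (F : Finset (Fin cands.length)) (r : ℕ)
    (β : BilinComp ((mulBilin (ZMod 2) l m n).comp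
      (constrSubF (K.map (form l m)) (candF l m cands) F).subtype) (Fin r)) :
    lbOf osC table F ≤ r := by
  simp only [lbOf, lookVal]
  split
  · next e he =>
    have hmem := List.mem_of_find?_eq_some he
    have hfm : e.1 = maskOfF F := by simpa using List.find?_some he
    rw [tableOK, List.all_eq_true] at htab
    have hv := htab e hmem
    simp only [Bool.and_eq_true, decide_eq_true_eq] at hv
    have h1 : Cert l m n (K ++ extraOf cands (maskOfF F)) (bnd osC e.2.1) := by
      rw [← hfm]
      exact le_of_sandB hv.2 (IH _ hv.1)
    exact h1 r (β.ofLE (subOf_append_le K cands F))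
  · exact Nat.zero_le _

/-- Soundness of a transposed lookup table. -/
theorem lbOfT_le {l n : ℕ} (osC : List Orbit) (i : ℕ) (IH : ∀ j < i, Cert l l n (kOf osC j) (bnd osC j))
    (K cands : List ℕ) (tableT : List LookRow) (htab : tableTOK l osC i K cands tableT = true)
    (F : Finset (Fin cands.length)) (r : ℕ)
    (β : BilinComp ((mulBilin (ZMod 2) l l n).comp
      (constrSubF (K.map (form l l)) (candF l l cands) F).subtype) (Fin r)) :
    lbOf osC tableT F ≤ r := by
  simp only [lbOf, lookVal]
  split
  · next e he =>
    have hmem := List.mem_of_find?_eq_some he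
    have hfm : e.1 = maskOfF F := by simpa using List.find?_some he
    rw [tableTOK, List.all_eq_true] at htab
    have hv := htab e hmem
    simp only [Bool.and_eq_true, decide_eq_true_eq] at hv
    have h1 : Cert l l n (K ++ extraOf cands (maskOfF F)) (bnd osC e.2.1) := by
      rw [← hfm]
      exact le_of_sandTB hv.2 (IH _ hv.1)
    exact h1 r (β.ofLE (subOf_append_le K cands F))
  · exact Nat.zero_le _

/-- Soundness of the two-table oracle. -/
theorem lbOf2_le {l n : ℕ} (osC : List Orbit) (i : ℕ) (IH : ∀ j < i, Cert l l n (kOf osC j) (bnd osC j))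
    (K cands : List ℕ) (table tableT : List LookRow) (htab : tableOK l l osC i K cands table = true)
    (htabT : tableTOK l osC i K cands tableT = true) (F : Finset (Fin cands.length)) (r : ℕ)
    (β : BilinComp ((mulBilin (ZMod 2) l l n).comp
      (constrSubF (K.map (form l l)) (candF l l cands) F).subtype) (Fin r)) :
    lbOf2 osC table tableT F ≤ r :=
  max_le (lbOf_le osC i IH K cands table htab F r β) (lbOfT_le osC i IH K cands tableT htabT F r β)

/-- Soundness of one extended step. -/
theorem stepBoundX_sound (os : List OrbitX) (i : ℕ)
    (IH : ∀ j < i, Cert l l n (kOf (coreOf os) j) (bnd (coreOf os) j))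
    (K : List ℕ) (cur : ℕ) (hcur : Cert l l n K cur) (st : StepX) (hob : StepXOblig l n st) :
    Cert l l n K (stepBoundX l n os i K cur st) := by
  cases st with
  | old st => exact stepBound_sound (coreOf os) i IH K cur hcur st hob
  | lookT extra j P Pi Q Qi =>
    simp only [stepBoundX]
    split
    · next h => exact cert_of_append (le_of_sandTB h.2 (IH j h.1))
    · exact fun _ _ => Nat.zero_le _
  | lp cands target table tableT rows D =>
    simp only [stepBoundX]
    split
    · next h =>
      obtain ⟨hcov, htab, htabT, hleaf⟩ := h
      intro r β
      have := le_card_of_lpLeafMB_zero (φ := mulBilin (ZMod 2) l l n) (K := K.map (form l l))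
        (c := candF l l cands) (lbOf2_le (osC := coreOf os) i IH K cands table tableT htab htabT)
        (cover_of_coverB hcov) hleaf β
      simpa using this
    · exact fun _ _ => Nat.zero_le _
  | dfsLP cands target x b c table tableT roots =>
    simp only [stepBoundX]
    split
    · next h =>
      obtain ⟨htgt, hnz, hcov, htab, htabT, hroot⟩ := h
      intro r β
      have := le_card_of_checkM_root (φ := mulBilin (ZMod 2) l l n) (K := K.map (form l l))
        (c := candF l l cands) (lbOf2_le (osC := coreOf os) i IH K cands table tableT htab htabT)
        (cover_of_coverB hcov) (psiK_ne_zero hnz)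
        (fun r' β' => by have := hcur r' β'; omega) roots hroot β
      simpa using this
    · exact fun _ _ => Nat.zero_le _

/-- Soundness of the fold over extended steps. -/
theorem foldl_soundX (os : List OrbitX) (i : ℕ)
    (IH : ∀ j < i, Cert l l n (kOf (coreOf os) j) (bnd (coreOf os) j)) (K : List ℕ) :
    ∀ (steps : List StepX) (cur : ℕ), Cert l l n K cur → (∀ st ∈ steps, StepXOblig l n st) →
      Cert l l n K (steps.foldl (fun cur st => max cur (stepBoundX l n os i K cur st)) cur)
  | [], cur, hcur, _ => hcur
  | st :: steps, cur, hcur, hob => by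
    rw [List.foldl_cons]
    refine foldl_soundX os i IH K steps _ (fun r β => ?_)
      (fun st' hst' => hob st' (List.mem_cons_of_mem _ hst'))
    exact max_le (hcur r β) (stepBoundX_sound os i IH K cur hcur st (hob st List.mem_cons_self) r β)

/-- **The extended sweep**: if every orbit check passes and all residual obligations hold, every claimed
bound is a lower bound for all computations on its constraint subspace. -/
theorem sweepX (os : List OrbitX) (hall : ∀ i < os.length, orbitCheckX l n os i = true)
    (hob : ∀ i < os.length, ObligsX l n os i) :
    ∀ i < os.length, Cert l l n (kOf (coreOf os) i) (bnd (coreOf os) i) := by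
  intro i
  induction i using Nat.strong_induction_on with
  | _ i IHi =>
    intro hi
    have IH : ∀ j < i, Cert l l n (kOf (coreOf os) j) (bnd (coreOf os) j) :=
      fun j hj => IHi j hj (lt_trans hj hi)
    have hc := hall i hi
    rw [orbitCheckX, decide_eq_true_eq] at hc
    have hf := foldl_soundX os i IH (kOf (coreOf os) i) (os.getD i default).steps 0
      (fun _ _ => Nat.zero_le _) (hob i hi)
    exact fun r β => hc.trans (hf r β)

/-- **Reading off the rank bound** at the unconstrained orbit. -/
theorem le_tensorRank_of_sweepX (os : List OrbitX) (hall : ∀ i < os.length, orbitCheckX l n os i = true)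
    (hob : ∀ i < os.length, ObligsX l n os i) (i : ℕ) (hi : i < os.length)
    (hK : kOf (coreOf os) i = []) :
    bnd (coreOf os) i ≤ tensorRank (matMulTensor (ZMod 2) l l n) := by
  have h := sweepX os hall hob i hi
  rw [hK] at h
  exact le_tensorRank_matMulTensor_of_forall_constrained (subOf l l []) h

end Summit.MatrixMultiplication.OmegaCensus.GF2RankLB
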